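import Summits.NavierStokesRegularity.NavierStokesRegularity.Theses.LebesgueExponentPincer
import Literature.Analysis.FluidPDE.NSQuasipotential
import Literature.Analysis.FluidPDE.MollifiedSliceTools
import Literature.Analysis.FluidPDE.LerayLocalRegularH1Proofs

/-!
# Disproof of `StrongCriticalityBreaking` — findings
(crux stmt-NavierStokesRegularity-19241 of route LebesgueExponentPincer; refuter birth vetting
`rattack`, 2026-08-17). Everything below elaborates sorry-free; prose only in docstrings.

The crux K2: `∃ δ ∈ (0,1), ∀ ν T > 0, ∀ (u, p)` classical NS on `[0,T)`, Leray–Hopf on `[0,T]` from the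
rapidly decaying datum `u 0`, `sup_{t∈[0,T)} ‖u t‖_{L^{3-δ}} < ∞ ⟹ HasSmoothExtensionPast ν 0 u T`
— Barker–Prange's *strong* criticality breaking (arXiv:2012.09776 p.2; survey arXiv:2211.16215 §9,
PDF p.17: "we are not aware of any regularity mechanism enabling to break the criticality barrier
based on the sole knowledge of such a supercritical bound"), restricted to first blow-up times of
smooth flows from Schwartz-class data.

## Verdict of this cycle: NO KILL — the crux survives every cheap attack, for a structural reason

A counterexample is a finite-time singularity of a classical Leray–Hopf flow from a rapidly decaying
datum (with a bounded supercritical Lebesgue norm): that is a negative solution of the Millennium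
problem itself (modulo weak–strong uniqueness), so no unconditional `¬ K2` is within reach, and no
printed blow-up scenario for TRUE Navier–Stokes exists. Conversely K2 implies regularity of
`L^∞_t L^{3,∞}_x`-bounded (Type-I) flows from such data (Lorentz interpolation, BP21 §4), open since
Leray — so no cheap proof either.

## What is recorded as theorems

* §1 `hypotheses_satisfiable`, `conclusion_holds_at_rest`: not vacuous; the only constructible model
  (rest state) meets all four hypotheses with the `ℝ≥0∞` supremum evaluating honestly to `0`, and
  satisfies the conclusion — no junk-model refutation (A3/A4).
* §2 restates-summit probes (pure logic in the route frame):
  `strongCriticalityBreaking_of_noBlowup` (NoBlowup → K2: K2 is a CONSEQUENCE of no-blow-up, hence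
  of the summit modulo weak–strong uniqueness — never summit-strength by itself; `K2 → S` would need
  the open a-priori jaw K1);
  `k2At_one_iff_noBlowup` (the excluded endpoint `δ = 1`, exponent `2`, is LITERALLY NoBlowup: the
  `L²` sup is automatic from the energy inequality — this is what `δ < 1` guards);
  `K2min`, `k2min_of_strongCriticalityBreaking`, `k2min_iff_pointwise_delta`, `closes_min`
  (the pincer closes already with the WEAKER residual "bounded in every `L^q`, `2<q<3` ⟹ extends",
  i.e. a solution-dependent `δ`; the filed crux — one uniform `δ` for all solutions of all sizes — is
  stronger than its own assembly needs: sharpening note for the planner, not a defect).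
* §3 `strongCriticalityBreaking_false_without_classical`: with the clause
  `IsClassicalNSSolutionOn (Ico 0 T) ν 0 u p` DELETED the statement is FALSE — witness: the rest state
  spiked by a unit vector at the single space–time point `(1/2, 0)`; every Leray–Hopf clause reads
  slices only a.e. (`IsLerayHopfOn.congr_ae_slices`), the `eLpNorm`-supremum ignores null sets, the
  datum is untouched, but a classical extension must reproduce the discontinuous slice `u (1/2)`
  pointwise. MEANING FOR PROVERS: the conclusion is about the continuous representative; any
  weak/mild-class argument (weak–strong uniqueness, ε-regularity) must be brought back to it through
  the classical clause.
* §4 `trivial_of_nonpos`: `0 < T` only excludes a degenerate-true instance (`Ico 0 T = ∅`).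

Hypothesis mutations with NO cheap witness (each would itself be a blow-up theorem): drop
`IsLerayHopfOn` (parasitic drifts `u = g(t)`, potential flows, Beltrami/Landau fields all violate the
finite `L^{3-δ}(ℝ³)` norm: no nonzero harmonic or `|x|⁻¹`-tailed field lies in `L^{3-δ}(ℝ³)`);
drop `HasRapidSpatialDecay` (blow-up from smooth `L²` data — unknown); drop `0 < ν` (smooth Euler
blow-up from Schwartz data on `ℝ³` — unknown).
-/

set_option linter.dupNamespace false

noncomputable section

namespace Summit.NavierStokesRegularity.NavierStokesRegularity.Cruxes.StrongCriticalityBreaking.Disproof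

open MeasureTheory Set Filter Topology Literature.Analysis.FluidPDE
open scoped ENNReal
open Summit.NavierStokesRegularity.NavierStokesRegularity.Theses.LebesgueExponentPincer

local notation "ℝ³" => EuclideanSpace ℝ (Fin 3)

/-! ## §1 Non-vacuity and the rest state -/

/-- The zero datum decays rapidly (all Fréchet derivatives vanish). [folklore] -/
theorem hasRapidSpatialDecay_zero : HasRapidSpatialDecay (0 : ℝ³ → ℝ³) := by
  intro n K
  refine ⟨0, fun x => ?_⟩
  rw [iteratedFDeriv_zero]
  simp

/-- The supercritical sup-norm hypothesis evaluates to `0` at the rest state (no junk). [folklore] -/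
theorem iSup_eLpNorm_zero (T q : ℝ) :
    (⨆ t ∈ Set.Ico 0 T, eLpNorm ((0 : ℝ → ℝ³ → ℝ³) t) (ENNReal.ofReal q) volume) = 0 := by
  simp

/-- **Non-vacuity (A3)**: all four hypotheses of the crux hold at once (rest state, `ν = T = 1`,
every exponent). [folklore] -/
theorem hypotheses_satisfiable (δ : ℝ) :
    ∃ (ν T : ℝ) (u : ℝ → ℝ³ → ℝ³) (p : ℝ → ℝ³ → ℝ), 0 < ν ∧ 0 < T ∧
      IsClassicalNSSolutionOn (Set.Ico 0 T) ν 0 u p ∧ IsLerayHopfOn T ν 0 (u 0) u ∧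
      HasRapidSpatialDecay (u 0) ∧
      (⨆ t ∈ Set.Ico 0 T, eLpNorm (u t) (ENNReal.ofReal (3 - δ)) volume) < ⊤ := by
  refine ⟨1, 1, 0, 0, one_pos, one_pos, isClassicalNSSolutionOn_zero _ 1,
    isLerayHopfOn_zero (E := ℝ³) 1 1, hasRapidSpatialDecay_zero, ?_⟩
  rw [iSup_eLpNorm_zero]
  exact ENNReal.zero_lt_top

/-- **The junk model does not refute (A4)**: at rest the conclusion holds (extend by rest). [folklore] -/
theorem conclusion_holds_at_rest (ν T : ℝ) :
    HasSmoothExtensionPast ν 0 (0 : ℝ → ℝ³ → ℝ³) T :=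
  ⟨T + 1, lt_add_one T, 0, 0, isClassicalNSSolutionOn_zero _ ν, fun _ _ => rfl⟩

/-! ## §2 Restates-summit probes and the strength of the filed crux -/

/-- Plain no-blow-up in the route frame (= the antecedent of the proved support `NoBlowupToClay`,
stmt-NavierStokesRegularity-0055). -/
def NoBlowup : Prop :=
  ∀ (ν T : ℝ), 0 < ν → 0 < T → ∀ (u : ℝ → ℝ³ → ℝ³) (p : ℝ → ℝ³ → ℝ),
    IsClassicalNSSolutionOn (Set.Ico 0 T) ν 0 u p → IsLerayHopfOn T ν 0 (u 0) u →
    HasRapidSpatialDecay (u 0) → HasSmoothExtensionPast ν 0 u T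

/-- `NoBlowupToClay` is literally `NoBlowup → NavierStokesRegularity`. -/
example : NoBlowupToClay ↔ (NoBlowup → _root_.NavierStokesRegularity) := Iff.rfl

/-- **S → C direction**: the crux follows from plain no-blow-up (take `δ = 1/2`, discard the
supercritical hypothesis). So it is weaker-or-equal to the summit (modulo weak–strong uniqueness),
never a hidden restatement from above. [folklore] -/
theorem strongCriticalityBreaking_of_noBlowup (h : NoBlowup) : StrongCriticalityBreaking :=
  ⟨1 / 2, by norm_num, by norm_num,
    fun ν T hν hT u p hcl hLH hdec _ => h ν T hν hT u p hcl hLH hdec⟩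

/-- The crux at a FIXED breaking parameter `δ` (K2 is `∃ δ ∈ (0,1), K2At δ`). -/
def K2At (δ : ℝ) : Prop :=
  ∀ (ν T : ℝ), 0 < ν → 0 < T → ∀ (u : ℝ → ℝ³ → ℝ³) (p : ℝ → ℝ³ → ℝ),
    IsClassicalNSSolutionOn (Set.Ico 0 T) ν 0 u p → IsLerayHopfOn T ν 0 (u 0) u →
    HasRapidSpatialDecay (u 0) →
    (⨆ t ∈ Set.Ico 0 T, eLpNorm (u t) (ENNReal.ofReal (3 - δ)) volume) < ⊤ →
    HasSmoothExtensionPast ν 0 u T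

/-- `StrongCriticalityBreaking ↔ ∃ δ ∈ (0,1), K2At δ` (definitional). -/
theorem strongCriticalityBreaking_iff : StrongCriticalityBreaking ↔ ∃ δ : ℝ, 0 < δ ∧ δ < 1 ∧ K2At δ :=
  Iff.rfl

/-- **The energy class controls the endpoint exponent**: for an unforced Leray–Hopf solution from
`u 0` (with `0 ≤ ν`), `sup_{t∈[0,T)} ‖u t‖_{L²} ≤ ‖u 0‖_{L²} < ∞` (Leray 1934, (5.2); tree
`IsLerayHopfOn.eLpNorm_le_eLpNorm_datum`). [folklore] -/
theorem iSup_eLpNorm_two_lt_top {ν T : ℝ} (hν : 0 ≤ ν) (hT : 0 < T) {u : ℝ → ℝ³ → ℝ³}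
    (hLH : IsLerayHopfOn T ν 0 (u 0) u) :
    (⨆ t ∈ Set.Ico 0 T, eLpNorm (u t) 2 volume) < ⊤ := by
  have h0 : MemLp (u 0) 2 volume := hLH.memLp 0 ⟨le_rfl, hT.le⟩
  refine lt_of_le_of_lt (iSup₂_le fun t ht => ?_) h0.eLpNorm_lt_top
  exact hLH.eLpNorm_le_eLpNorm_datum hν h0 (Ico_subset_Icc_self ht)

/-- **Degenerate endpoint `δ = 1` (exponent `2`) is LITERALLY no-blow-up**: there the supercritical
hypothesis is automatic from the energy inequality. This is the instance the side condition `δ < 1`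
excludes; with `δ ≤ 1` admitted the crux would contain a summit-strength instance. [folklore] -/
theorem k2At_one_iff_noBlowup : K2At 1 ↔ NoBlowup := by
  have h2 : ENNReal.ofReal (3 - 1) = 2 := by norm_num
  constructor
  · intro h ν T hν hT u p hcl hLH hdec
    refine h ν T hν hT u p hcl hLH hdec ?_
    rw [h2]
    exact iSup_eLpNorm_two_lt_top hν.le hT hLH
  · intro h ν T hν hT u p hcl hLH hdec _
    exact h ν T hν hT u p hcl hLH hdec

/-- The MINIMAL residual the pincer needs: regularity for flows bounded in EVERY `L^q`, `2<q<3`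
(equivalently, by `k2min_iff_pointwise_delta`, a solution-dependent `δ`). -/
def K2min : Prop :=
  ∀ (ν T : ℝ), 0 < ν → 0 < T → ∀ (u : ℝ → ℝ³ → ℝ³) (p : ℝ → ℝ³ → ℝ),
    IsClassicalNSSolutionOn (Set.Ico 0 T) ν 0 u p → IsLerayHopfOn T ν 0 (u 0) u →
    HasRapidSpatialDecay (u 0) →
    (∀ q : ℝ, 2 < q → q < 3 → (⨆ t ∈ Set.Ico 0 T, eLpNorm (u t) (ENNReal.ofReal q) volume) < ⊤) →
    HasSmoothExtensionPast ν 0 u T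

/-- The filed crux (one uniform `δ`) implies the minimal residual. [folklore] -/
theorem k2min_of_strongCriticalityBreaking (h : StrongCriticalityBreaking) : K2min := by
  obtain ⟨δ, hδ0, hδ1, hK⟩ := h
  intro ν T hν hT u p hcl hLH hdec hall
  exact hK ν T hν hT u p hcl hLH hdec (hall (3 - δ) (by linarith) (by linarith))

/-- `K2min` is exactly the solution-dependent-`δ` reading of K2 (pure logic: `∃ δ, (A δ → B)` iff
`(∀ δ, A δ) → B` over the nonempty range `(0,1)`). [folklore] -/
theorem k2min_iff_pointwise_delta :
    K2min ↔ ∀ (ν T : ℝ), 0 < ν → 0 < T → ∀ (u : ℝ → ℝ³ → ℝ³) (p : ℝ → ℝ³ → ℝ),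
      IsClassicalNSSolutionOn (Set.Ico 0 T) ν 0 u p → IsLerayHopfOn T ν 0 (u 0) u →
      HasRapidSpatialDecay (u 0) → ∃ δ : ℝ, 0 < δ ∧ δ < 1 ∧
      ((⨆ t ∈ Set.Ico 0 T, eLpNorm (u t) (ENNReal.ofReal (3 - δ)) volume) < ⊤ →
        HasSmoothExtensionPast ν 0 u T) := by
  constructor
  · intro h ν T hν hT u p hcl hLH hdec
    by_cases hall : ∀ q : ℝ, 2 < q → q < 3 →
        (⨆ t ∈ Set.Ico 0 T, eLpNorm (u t) (ENNReal.ofReal q) volume) < ⊤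
    · exact ⟨1 / 2, by norm_num, by norm_num, fun _ => h ν T hν hT u p hcl hLH hdec hall⟩
    · push Not at hall
      obtain ⟨q, hq2, hq3, hq⟩ := hall
      refine ⟨3 - q, by linarith, by linarith, fun hfin => ?_⟩
      have : (3 : ℝ) - (3 - q) = q := by ring
      rw [this] at hfin
      exact absurd hfin (not_lt.2 hq)
  · intro h ν T hν hT u p hcl hLH hdec hall
    obtain ⟨δ, hδ0, hδ1, hK⟩ := h ν T hν hT u p hcl hLH hdec
    exact hK (hall (3 - δ) (by linarith) (by linarith))

/-- **The pincer closes with the weaker residual**: `SuperEnergyJaw → K2min → NoBlowupToClay → S`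
(same three lines as the route's `closes`, the jaw now feeding every `q`). [folklore] -/
theorem closes_min (h₁ : SuperEnergyJaw) (h₂ : K2min) (h₃ : NoBlowupToClay) :
    _root_.NavierStokesRegularity :=
  h₃ fun ν T hν hT u p hcl hLH hdec =>
    h₂ ν T hν hT u p hcl hLH hdec fun q hq2 hq3 => h₁ q hq2 hq3 ν T hν hT u p hcl hLH hdec

/-! ## §3 Load-bearing analysis: the classical clause -/

/-- The crux with the clause `IsClassicalNSSolutionOn (Ico 0 T) ν 0 u p` DELETED (the pressure
binder then carries nothing and is dropped too). -/
def StrongCriticalityBreakingWithoutClassical : Prop :=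
  ∃ δ : ℝ, 0 < δ ∧ δ < 1 ∧ ∀ (ν T : ℝ), 0 < ν → 0 < T → ∀ (u : ℝ → ℝ³ → ℝ³),
    IsLerayHopfOn T ν 0 (u 0) u → HasRapidSpatialDecay (u 0) →
    (⨆ t ∈ Set.Ico 0 T, eLpNorm (u t) (ENNReal.ofReal (3 - δ)) volume) < ⊤ →
    HasSmoothExtensionPast ν 0 u T

/-- A fixed nonzero vector `e₀ = (1,0,0)`. -/
def e0 : ℝ³ := EuclideanSpace.single 0 1

theorem e0_ne_zero : e0 ≠ 0 := by
  intro h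
  have := congrArg (fun v : ℝ³ => v 0) h
  simp [e0] at this

/-- **The witness**: the rest state spiked by `e₀` at the single space–time point `(1/2, 0)`. -/
def spike : ℝ → ℝ³ → ℝ³ := fun t x => if t = 1 / 2 ∧ x = 0 then e0 else 0

theorem spike_time_zero : spike 0 = 0 := by
  funext x
  simp [spike]

theorem spike_half_zero : spike (1 / 2) 0 = e0 := by
  simp [spike]

theorem spike_of_ne {t : ℝ} {x : ℝ³} (hx : x ≠ 0) : spike t x = 0 := by
  simp [spike, hx]

/-- Every slice of the spike is a.e. the zero field (it differs from `0` at most at `x = 0`). -/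
theorem spike_slice_ae (t : ℝ) : spike t =ᵐ[volume] (0 : ℝ → ℝ³ → ℝ³) t := by
  have hnull : volume ({0} : Set ℝ³) = 0 := measure_singleton 0
  refine measure_mono_null (fun x hx => ?_) hnull
  by_contra h0
  exact hx (by simp [spike_of_ne h0])

/-- The spike is a.e. the zero space–time field (it differs from `0` at most at `(1/2, 0)`). -/
theorem uncurry_spike_ae :
    Function.uncurry spike =ᵐ[volume] fun _ : ℝ × ℝ³ => (0 : ℝ³) := by
  have : NullSingletonClass (volume : Measure (ℝ × ℝ³)) :=
    Measure.prod.instNullSingletonClass_fst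
  have hnull : volume ({((1 : ℝ) / 2, (0 : ℝ³))} : Set (ℝ × ℝ³)) = 0 := measure_singleton _
  refine measure_mono_null (fun z hz => ?_) hnull
  obtain ⟨t, x⟩ := z
  by_contra h0
  have hx : ¬ (t = 1 / 2 ∧ x = 0) := fun h => h0 (by rw [h.1, h.2]; rfl)
  have hval : spike t x = 0 := if_neg hx
  exact hz hval

/-- The spike is Leray–Hopf from the datum `0` on every `[0, T)`, `T > 0` (a.e.-modification of the
resting Leray–Hopf solution, tree `IsLerayHopfOn.congr_ae_slices`). [folklore] -/
theorem isLerayHopfOn_spike {ν T : ℝ} (hT : 0 < T) : IsLerayHopfOn T ν 0 (spike 0) spike := by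
  rw [spike_time_zero]
  have hae : (fun _ : ℝ × ℝ³ => (0 : ℝ³)) =ᵐ[(volume : Measure (ℝ × ℝ³)).restrict (Ioo 0 T ×ˢ univ)]
      Function.uncurry spike :=
    Filter.EventuallyEq.symm (ae_restrict_of_ae uncurry_spike_ae)
  have hvm : AEStronglyMeasurable (Function.uncurry spike)
      ((volume : Measure (ℝ × ℝ³)).restrict (Ioo 0 T ×ˢ univ)) :=
    (aestronglyMeasurable_const (b := (0 : ℝ³))).congr hae
  exact (isLerayHopfOn_zero (E := ℝ³) T ν).congr_ae_slices hT hvm fun t _ => spike_slice_ae t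

/-- The supercritical supremum of the spike is `0` (the seminorm ignores null sets). -/
theorem iSup_eLpNorm_spike (T : ℝ) (q : ℝ≥0∞) :
    (⨆ t ∈ Set.Ico 0 T, eLpNorm (spike t) q volume) = 0 := by
  have h : ∀ t, eLpNorm (spike t) q volume = 0 := fun t => by
    rw [eLpNorm_congr_ae (spike_slice_ae t)]
    simp
  simp [h]

/-- The spiked slice `spike (1/2)` is not continuous at `0`, so no classical field reproduces it. -/
theorem not_continuous_spike_half : ¬ Continuous (spike (1 / 2)) := by
  intro hc
  have h1 : Tendsto (spike (1 / 2)) (𝓝[≠] (0 : ℝ³)) (𝓝 (spike (1 / 2) 0)) :=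
    (hc.tendsto 0).mono_left nhdsWithin_le_nhds
  have h2 : Tendsto (spike (1 / 2)) (𝓝[≠] (0 : ℝ³)) (𝓝 0) := by
    refine (tendsto_const_nhds (x := (0 : ℝ³))).congr' ?_
    exact eventually_nhdsWithin_of_forall fun x hx => (spike_of_ne hx).symm
  have := tendsto_nhds_unique h1 h2
  rw [spike_half_zero] at this
  exact e0_ne_zero this

/-- The spike admits no classical extension past any `T > 1/2`. -/
theorem not_hasSmoothExtensionPast_spike {ν T : ℝ} (hT : 1 / 2 < T) :
    ¬ HasSmoothExtensionPast ν 0 spike T := by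
  rintro ⟨T', hT', u', p', hcl, hagree⟩
  have hmem : (1 / 2 : ℝ) ∈ Ico 0 T := ⟨by norm_num, hT⟩
  have hmem' : (1 / 2 : ℝ) ∈ Ico 0 T' := ⟨by norm_num, hT.trans hT'⟩
  have hcont : Continuous (u' (1 / 2)) := (hcl.contDiff_velocity hmem').continuous
  rw [hagree _ hmem] at hcont
  exact not_continuous_spike_half hcont

/-- **The classical clause is load-bearing** ("any proof must use it, and through the continuous
representative"): without it the statement is false for EVERY `δ`, witnessed by the spiked rest
state (`ν = T = 1`). [folklore] -/
theorem strongCriticalityBreaking_false_without_classical :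
    ¬ StrongCriticalityBreakingWithoutClassical := by
  rintro ⟨δ, -, -, h⟩
  have hdec : HasRapidSpatialDecay (spike 0) := by
    rw [spike_time_zero]
    exact hasRapidSpatialDecay_zero
  have hbd : (⨆ t ∈ Set.Ico 0 (1 : ℝ), eLpNorm (spike t) (ENNReal.ofReal (3 - δ)) volume) < ⊤ := by
    rw [iSup_eLpNorm_spike]
    exact ENNReal.zero_lt_top
  exact not_hasSmoothExtensionPast_spike (by norm_num)
    (h 1 1 one_pos one_pos spike (isLerayHopfOn_spike one_pos) hdec hbd)

/-! ## §4 Decoration: the positivity of `T` -/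

/-- `0 < T` only excludes a degenerate-TRUE instance: for `T ≤ 0` every field extends past `T`
(`Ico 0 T = ∅`; the rest state on `[0,1)` agrees with it there). [folklore] -/
theorem trivial_of_nonpos {ν T : ℝ} (hT : T ≤ 0) (u : ℝ → ℝ³ → ℝ³) :
    HasSmoothExtensionPast ν 0 u T :=
  ⟨1, by linarith, 0, 0, isClassicalNSSolutionOn_zero _ _,
    fun t ht => absurd ht.2 (not_lt.2 (hT.trans ht.1))⟩

end Summit.NavierStokesRegularity.NavierStokesRegularity.Cruxes.StrongCriticalityBreaking.Disproof

end
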